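import Literature.NumberTheory.EllipticCurves.Kato2004.IntegralH1FiniteProofs
import Literature.NumberTheory.EllipticCurves.HeegnerModuleIndex
import HarnessLib

/-!
# Route `ByReductionTypeAtTwo` (rung K4), crux `SupersingularRankZeroAtTwo` (item stmt-BirchSwinnertonDyer-19097), line
# `odd_blind_package` v2.18, stub `stub_flatPackage`, conjunct (8), clause F1♭ `Exact loc toX` — **FIN-LAYER**: the
# integral classes of `H¹(ℚ_n, W[p^k])` form a FINITE set, at EVERY layer `n` of a `ℤ_p`-extension of `ℚ`
# (cell `bsd-2adic`, seat `bsd-2adic-t42` GEN 50, hand hF1♭-LEV, FILE 1 (S-FIN); `--supports 19097`, helper)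

HONEST FRAMING (D-0054): THEOREMS ONLY — no definition, no named fact, no instance, no notation, no `sorry`.  Helper
toward conjunct (8); closes NO stub; 19097 stays OPEN on its 5 registered stubs (v2.18); nothing is booked; BSD₂ is proved
for no supersingular curve and BSD for no curve by any of this; typed ≠ proved.  Generic prime `p`, every `W/ℚ`, every
`ℤ_p`-extension datum `κ` (no cyclotomic hypothesis), every `n, k`.

## What

★ `SSFlatPT.finite_integralH1_torsion_layer W κ n k` — the hypothesis (FIN) = `hfin` of
`SSFlatPT.exists_snd_coleman_apply_eq_of_levelwise` (file `…SupersingularFlatPTLimit`, p831689), VERBATIM: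
`Set.Finite {a : W.torsionH1Over ((p : ℤ) ^ k) (κ.layerSubgroup n) | a ∈ integralH1 (W.torsionGaloisModule ((p : ℤ) ^ k)) p (κ.layerSubgroup n)}`
— for every `n, k` the INTEGRAL classes of `H¹(Γ_n, W[p^k])` (`Γ_n = κ.layerSubgroup n = Gal(ℚ̄/ℚ_n)`; integral =
unramified away from `p` at class level, `Kato2004.integralH1`, Kato §8.2 / Lemma 8.5) form a finite set.  So
`fun n k ↦ finite_integralH1_torsion_layer W κ n k` IS `hfin` by `exact` (`finite_integralH1_torsion_allLayers`).

## Proof (Silverman AEC Lemma X.4.3 at the layer, Hom form; no Shapiro, no layer number field)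

Let `M := W[p^k]` (finite, discrete, continuous `Γ_ℚ`-action), `U := Γ_n` (open in `Γ_ℚ`), and
`V := U ⊓ Fix(M)` (`fixingSubgroupOfModule`), an OPEN subgroup of `Γ_ℚ` of finite index in `U`.  A continuous crossed
homomorphism `φ : U → M` is determined by `φ|_V` and its values on coset representatives of `U/V`
(`φ (g v) = φ g + g • φ v`), and if its class is integral then `φ|_V ∈ Hom(V, M; {p})` (`unramifiedHoms`): it is
additive (`V` fixes `M`) and vanishes on `V ∩ I_𝔓` for `𝔓 ∣ v ≠ p` (there `φ σ = σ • a − a = 0`).  Silverman's Prop. VIII.1.6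
in the Hom form for an arbitrary OPEN `V ≤ Γ_ℚ` is the tree theorem `finite_unramifiedHoms_holds ℚ` (Kummer theory +
Hermite–Minkowski, file `H1UnramifiedFiniteProofs`); hence the cocycles with integral class form a finite set, and so do
their classes (`oneCocycleClass_surjective`).  This is the reduction of `finite_h1Unramified_of_finite_unramifiedHoms`
(`H1UnramifiedFinite.lean`) run at the open subgroup `Γ_n` instead of `Γ_ℚ` — the route the hand's (D1) census chose
(«inflation–restriction to an open `V ≤ Γ_n` acting trivially on `W[p^k]` + finiteness of continuous homs from `V`
unramified outside `p`»), the tree carrying the second input for every open subgroup of `Γ_K`, `K` any number field.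

References: [SilvermanAEC2009] Prop. VIII.1.6, Lemma X.4.3; [Kato2004Asterisque] §8.2, Lemma 8.5 (pp. 180–184), §12.2
(p. 220); [SerreGaloisCohomology1997] I §2.2, I §5.8; [NeukirchSchmidtWingberg2008] (8.3.20).
-/

set_option autoImplicit false
-- the Theorems namespace of this sub repeats the summit name by design (D-0017 nested layout)
set_option linter.dupNamespace false

noncomputable section

open scoped Classical NumberField

namespace Summit.BirchSwinnertonDyer.BirchSwinnertonDyer.Theorems

namespace SSFlatPT

open CategoryTheory NumberField IsDedekindDomain Field WeierstrassCurve ContinuousCohomology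
  Literature.NumberTheory.EllipticCurves Literature.NumberTheory.GaloisRepresentations
  Literature.NumberTheory.EllipticCurves.Kato2004 ZpExtension

variable (W : WeierstrassCurve ℚ) [W.IsElliptic] {p : ℕ} [Fact p.Prime] (κ : ZpExtension ℚ p)

/-- **Cocycle form of FIN-LAYER.**  For `U := Γ_n = κ.layerSubgroup n` and `M := W[p^k]`, the continuous crossed
homomorphisms `φ : U → M` whose class in `H¹(Γ_n, W[p^k])` is INTEGRAL (`Kato2004.integralH1`: the restriction to
`U ⊓ I_𝔓` vanishes for every prime `𝔓` of `ℤ̄` above every `v ≠ p`) form a finite set: with `V := U ⊓ Fix(M)` (open),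
`φ ↦ (φ|_V, φ on coset representatives of U/V)` is injective (`φ (g v) = φ g + g • φ v`) with values in the finite set
`Hom(V, M; {p}) × M^{U/V}` (`finite_unramifiedHoms_holds ℚ`, Silverman Prop. VIII.1.6 in Hom form at the open `V`).
[cite: SilvermanAEC2009, Prop. VIII.1.6 and Lemma X.4.3 (proof)] [cite: Kato2004Asterisque, §8.2 Lemma 8.5 (pp. 180–184)] -/
theorem finite_setOf_oneCocycleClass_mem_integralH1_layer (n k : ℕ) :
    Set.Finite {φ : contOneCocycles (subgroupRep (W.torsionGaloisModule ((p : ℤ) ^ k)).toTopRep (κ.layerSubgroup n)) |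
      oneCocycleClass _ φ ∈ integralH1 (W.torsionGaloisModule ((p : ℤ) ^ k)) p (κ.layerSubgroup n)} := by
  classical
  have hp : p.Prime := Fact.out
  -- the finite discrete module `M = W[p^k]` with its continuous `Γ_ℚ`-action
  haveI : ContinuousSMul (absoluteGaloisGroup ℚ) (geomTorsion W ((p : ℤ) ^ k)) :=
    W.continuousSMul_geomTorsion (WeierstrassCurve.isOpen_stabilizer_point_holds W) _
  haveI : Finite (geomTorsion W ((p : ℤ) ^ k)) :=
    W.finite_torsionPoints_holds (AlgebraicClosure ℚ) (pow_ne_zero k (by exact_mod_cast hp.ne_zero))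
  -- the open subgroup `V = U ⊓ Fix(M)` and its trace `V'` on `U`
  set U : Subgroup (absoluteGaloisGroup ℚ) := κ.layerSubgroup n with hU
  set V : Subgroup (absoluteGaloisGroup ℚ) :=
    U ⊓ fixingSubgroupOfModule ℚ (geomTorsion W ((p : ℤ) ^ k)) with hVdef
  have hVU : V ≤ U := inf_le_left
  have hVopen : IsOpen (V : Set (absoluteGaloisGroup ℚ)) :=
    (κ.isOpen_layerSubgroup n).inter isOpen_fixingSubgroupOfModule
  have hfix : ∀ σ ∈ V, ∀ m : geomTorsion W ((p : ℤ) ^ k), σ • m = m := fun σ hσ m ↦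
    smul_eq_of_mem_fixingSubgroupOfModule hσ.2 m
  haveI : CompactSpace U := isCompact_iff_compactSpace.mp
    ((κ.layerSubgroup n).isClosed_of_isOpen (κ.isOpen_layerSubgroup n)).isCompact
  let V' : Subgroup U := V.subgroupOf U
  have hV' : IsOpen (V' : Set U) := hVopen.preimage continuous_subtype_val
  haveI : Finite (U ⧸ V') := Subgroup.quotient_finite_of_isOpen V' hV'
  -- Silverman VIII.1.6 (Hom form) at the open subgroup `V`, with `S = {p}`
  have hfinHom : (unramifiedHoms V (geomTorsion W ((p : ℤ) ^ k)) {primePlace p}).Finite :=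
    finite_unramifiedHoms_holds ℚ V hVopen (geomTorsion W ((p : ℤ) ^ k)) (Set.finite_singleton _)
  have hfin : ((unramifiedHoms V (geomTorsion W ((p : ℤ) ^ k)) {primePlace p}) ×ˢ
      (Set.univ : Set (U ⧸ V' → geomTorsion W ((p : ℤ) ^ k)))).Finite :=
    hfinHom.prod Set.finite_univ
  -- places `v ≠ primePlace p` have residue characteristic `≠ p`
  have hne : ∀ v : HeightOneSpectrum (𝓞 ℚ), v ∉ ({primePlace p} : Set (HeightOneSpectrum (𝓞 ℚ))) →
      ((Rat.HeightOneSpectrum.primesEquiv v : Nat.Primes) : ℕ) ≠ p := by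
    intro v hv h
    apply hv
    rw [Set.mem_singleton_iff]
    apply (Rat.HeightOneSpectrum.primesEquiv (R := 𝓞 ℚ)).injective
    rw [primesEquiv_primePlace]
    exact Subtype.ext h
  -- restriction to `V` and evaluation at coset representatives of `U/V'`
  let res : contOneCocycles (subgroupRep (W.torsionGaloisModule ((p : ℤ) ^ k)).toTopRep U) →
      (V → geomTorsion W ((p : ℤ) ^ k)) := fun φ v ↦ φ.1 ⟨(v : absoluteGaloisGroup ℚ), hVU v.2⟩
  let ev : contOneCocycles (subgroupRep (W.torsionGaloisModule ((p : ℤ) ^ k)).toTopRep U) →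
      (U ⧸ V' → geomTorsion W ((p : ℤ) ^ k)) := fun φ q ↦ φ.1 q.out
  have hinj : Function.Injective fun φ ↦ (res φ, ev φ) := by
    intro φ ψ hφψ
    simp only [Prod.mk.injEq] at hφψ
    obtain ⟨hres, hev⟩ := hφψ
    apply Subtype.ext
    ext g
    obtain ⟨u, hu⟩ := QuotientGroup.mk_out_eq_mul V' g
    have hg : g = (QuotientGroup.mk g : U ⧸ V').out * ((u⁻¹ : V') : U) := by
      rw [hu, Subgroup.coe_inv, mul_inv_cancel_right]
    have huV : (((u⁻¹ : V') : U) : absoluteGaloisGroup ℚ) ∈ V := Subgroup.mem_subgroupOf.mp (u⁻¹).2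
    have hcu : φ.1 ((u⁻¹ : V') : U) = ψ.1 ((u⁻¹ : V') : U) := by
      have h := congr_fun hres ⟨(((u⁻¹ : V') : U) : absoluteGaloisGroup ℚ), huV⟩
      have e : (⟨(((u⁻¹ : V') : U) : absoluteGaloisGroup ℚ), hVU huV⟩ : U) = ((u⁻¹ : V') : U) := rfl
      simpa only [res, e] using h
    have hq : φ.1 (QuotientGroup.mk g : U ⧸ V').out = ψ.1 (QuotientGroup.mk g : U ⧸ V').out :=
      congr_fun hev (QuotientGroup.mk g)
    rw [hg, φ.2, ψ.2, hq, hcu]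
  refine Set.Finite.of_finite_image (f := fun φ ↦ (res φ, ev φ)) (hfin.subset ?_) hinj.injOn
  rintro _ ⟨φ, hφ, rfl⟩
  refine ⟨⟨?_, fun σ τ ↦ ?_, fun v hv 𝔓 h𝔓 σ hσ ↦ ?_⟩, Set.mem_univ _⟩
  · -- continuity of `φ|_V`
    exact φ.1.continuous.comp (Continuous.subtype_mk continuous_subtype_val _)
  · -- additivity: `V` fixes `M`
    simp only [res, Subgroup.coe_mul]
    have e : (⟨((σ : absoluteGaloisGroup ℚ) * (τ : absoluteGaloisGroup ℚ)), hVU (V.mul_mem σ.2 τ.2)⟩ : U) =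
        (⟨(σ : absoluteGaloisGroup ℚ), hVU σ.2⟩ : U) * ⟨(τ : absoluteGaloisGroup ℚ), hVU τ.2⟩ := rfl
    rw [e, φ.2, subgroupRep_ρ_apply]
    congr 1
    exact Subtype.ext (congrArg Subtype.val (hfix σ σ.2 (φ.1 ⟨(τ : absoluteGaloisGroup ℚ), hVU τ.2⟩)))
  · -- vanishing on `V ∩ I_𝔓` for `𝔓 ∣ v ≠ p`: the class is integral
    have h0 := (mem_integralH1_iff _ p U _).mp hφ v (hne v hv) 𝔓 h𝔓
    rw [resLe_oneCocycleClass, oneCocycleClass_eq_zero_iff] at h0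
    obtain ⟨a, ha⟩ := h0
    have hσ' : (σ : absoluteGaloisGroup ℚ) ∈ U ⊓ 𝔓.inertia (absoluteGaloisGroup ℚ) := ⟨hVU σ.2, hσ⟩
    have key := ha ⟨(σ : absoluteGaloisGroup ℚ), hσ'⟩
    rw [contOneCocycles.pullback_apply, TopRep.hom_ofHom] at key
    have e : subgroupInclusion (inf_le_left : U ⊓ 𝔓.inertia (absoluteGaloisGroup ℚ) ≤ U)
        ⟨(σ : absoluteGaloisGroup ℚ), hσ'⟩ = ⟨(σ : absoluteGaloisGroup ℚ), hVU σ.2⟩ := Subtype.ext rfl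
    rw [e] at key
    simp only [res]
    rw [show φ.1 ⟨(σ : absoluteGaloisGroup ℚ), hVU σ.2⟩ = _ from key, subgroupRep_ρ_apply, sub_eq_zero]
    exact Subtype.ext (congrArg Subtype.val (hfix σ σ.2 a))

/-- ★ **FIN-LAYER** (hypothesis `hfin` of `SSFlatPT.exists_snd_coleman_apply_eq_of_levelwise`, VERBATIM): for every
`ℤ_p`-extension datum `κ` of `ℚ`, every layer `n` and every level `k`, the INTEGRAL classes of `H¹(Γ_n, W[p^k])`
(`Γ_n = κ.layerSubgroup n = Gal(ℚ̄/ℚ_n)`; `Kato2004.integralH1`, unramified away from `p` at class level) form a finite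
set — Hermite–Minkowski / Silverman Lemma X.4.3 at the layer `ℚ_n`, through the cocycle form
`finite_setOf_oneCocycleClass_mem_integralH1_layer` and `oneCocycleClass_surjective`.
[cite: SilvermanAEC2009, Lemma X.4.3] [cite: Kato2004Asterisque, §8.2 Lemma 8.5 (pp. 180–184) and §12.2 (p. 220)] -/
theorem finite_integralH1_torsion_layer (n k : ℕ) :
    Set.Finite {a : W.torsionH1Over ((p : ℤ) ^ k) (κ.layerSubgroup n) |
      a ∈ integralH1 (W.torsionGaloisModule ((p : ℤ) ^ k)) p (κ.layerSubgroup n)} := by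
  have hZ := finite_setOf_oneCocycleClass_mem_integralH1_layer W κ n k
  refine (hZ.image (oneCocycleClass _)).subset fun a ha ↦ ?_
  obtain ⟨φ, rfl⟩ :=
    oneCocycleClass_surjective (subgroupRep (W.torsionGaloisModule ((p : ℤ) ^ k)).toTopRep (κ.layerSubgroup n)) a
  exact ⟨φ, ha, rfl⟩

/-- FIN-LAYER for all layers and levels at once — literally the binder `hfin` of
`SSFlatPT.exists_snd_coleman_apply_eq_of_levelwise` (p831689), so that T-LIM consumes it by ONE `exact`.
[cite: SilvermanAEC2009, Lemma X.4.3] [cite: Kato2004Asterisque, §12.2 (p. 220)] -/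
theorem finite_integralH1_torsion_allLayers :
    ∀ n k : ℕ, Set.Finite {a : W.torsionH1Over ((p : ℤ) ^ k) (κ.layerSubgroup n) |
      a ∈ integralH1 (W.torsionGaloisModule ((p : ℤ) ^ k)) p (κ.layerSubgroup n)} :=
  fun n k ↦ finite_integralH1_torsion_layer W κ n k

end SSFlatPT

end Summit.BirchSwinnertonDyer.BirchSwinnertonDyer.Theorems

end
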